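import Mathlib.RingTheory.Regular.RegularSequence
import Mathlib.RingTheory.KrullDimension.Regular
import Mathlib.RingTheory.KrullDimension.NonZeroDivisors
import Mathlib.RingTheory.Ideal.KrullsHeightTheorem
import Mathlib.Order.KrullDimension
import Literature.RingTheory.TightClosure.TightClosure
import Literature.AlgebraicGeometry.Resolution.CohenMacaulayAvoidance
import HarnessLib

/-!
# In a Cohen–Macaulay local ring every system of parameters is a regular sequence

Support file for crux `FRationalModification` (route `ResolutionOfSingularities/FrobeniusLadder`,
line `Sketch`, stub `stub_sopWeaklyRegular`).

Let `(S, 𝔪)` be a Noetherian local ring which is Cohen–Macaulay in the tree's phrasing: there is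
an `S`-regular sequence in `𝔪` of length `dim S` (the hypothesis of
`Literature.AlgebraicGeometry.Resolution.isRegular_of_forall_notMem_minimalPrimes`,
`…minimalPrimes_of_mem_associatedPrimes`, `…exists_isRegular_quotSMulTop`). Then every system of
parameters `s : Fin n → S` (`n = dim S`, `rad (s) = 𝔪`,
`Literature.RingTheory.TightClosure.IsSystemOfParameters`) is a weakly regular sequence on `S`
IN THE GIVEN ORDER (`stub_sopWeaklyRegular`; Matsumura, Thm. 17.4 (iii)). This converts the
Cohen–Macaulay datum of a local chart into the hypothesis `hCM` of the landed tight-closure lemmas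
of the line (`stub_deformFW`, `stub_powerLift`, `stub_exchange`).

Proof (Matsumura's, by induction on `n`, for all rings at once —
`isWeaklyRegular_ofFn_of_isSystemOfParameters_aux`). For `n + 1` put `x = s 0` and
`S̄ = S/(x)`. The images `s̄'` of `s 1, …, s n` generate an ideal of `S̄` with radical `𝔪̄`, so
`dim S̄ = ht 𝔪̄ ≤ n` by Krull's height theorem. Every associated prime `𝔭` of `S` has coheight
`≥ n + 1` (the unmixedness inequality `length_le_coheight_of_mem_associatedPrimes`), while a prime
containing `x` has coheight `≤ dim S̄ ≤ n` (`coheight_le_ringKrullDim_quotient`); hence `x` lies in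
no associated prime and is a non-zero-divisor. Cutting down (`exists_isRegular_quotSMulTop`,
`isRegular_quotient_of_isRegular_quotSMulTop`) makes `S̄` again Cohen–Macaulay, of dimension `n`
(`ringKrullDim_quotient_span_singleton_succ_eq_ringKrullDim`), and `s̄'` is a system of parameters
of `S̄`; by induction it is weakly regular on `S̄`, and `x :: (s 1, …, s n)` is weakly regular on
`S` (`RingTheory.Sequence.IsWeaklyRegular.cons` along `S/xS ≃ S̄`).

No characteristic, domain or tight-closure hypothesis is involved.

## References

* [Matsumura1987] H. Matsumura, *Commutative Ring Theory*, CUP 1986, Thm. 17.4 (iii)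
  ("if `A` is a CM local ring, every system of parameters is an `A`-sequence").
-/

-- the summit and its single problem share the name `ResolutionOfSingularities`
-- (path-aligned namespace)
set_option linter.dupNamespace false

namespace Summit.ResolutionOfSingularities.ResolutionOfSingularities.Theorems.FRationalModification.SopWeaklyRegular

open IsLocalRing RingTheory.Sequence Literature.RingTheory.TightClosure
  Literature.AlgebraicGeometry.Resolution
open scoped Pointwise

universe u

/-- If `I ⊆ 𝔭` then the coheight of the prime `𝔭` in `Spec R` is at most `dim R/I` (chains of
primes above `𝔭` are chains in `V(I) ≅ Spec R/I`). [folklore] -/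
theorem coheight_le_ringKrullDim_quotient {R : Type*} [CommRing R] {I : Ideal R}
    (P : PrimeSpectrum R) (h : I ≤ P.asIdeal) :
    ((Order.coheight P : ℕ∞) : WithBot ℕ∞) ≤ ringKrullDim (R ⧸ I) := by
  rw [Order.coheight_eq_krullDim_Ici, ringKrullDim_quotient]
  exact Order.krullDim_le_of_strictMono
    (fun Q : Set.Ici P => (⟨Q.1, (PrimeSpectrum.mem_zeroLocus _ _).mpr
      fun r hr => ((PrimeSpectrum.asIdeal_le_asIdeal _ _).mpr Q.2) (h hr)⟩ :
        PrimeSpectrum.zeroLocus (I : Set R)))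
    fun _ _ hlt => hlt

/-- **Matsumura Thm. 17.4 (iii), inductive form**: for every Noetherian local ring `S` with an
`S`-regular sequence in `𝔪` of length `dim S`, every system of parameters `s : Fin n → S` is a
weakly regular sequence on `S` (induction on `n`, for all rings at once).
[cite: Matsumura1987, Thm. 17.4 (iii)] -/
theorem isWeaklyRegular_ofFn_of_isSystemOfParameters_aux (n : ℕ) :
    ∀ (S : Type u) [CommRing S] [IsNoetherianRing S] [IsLocalRing S] (rs : List S),
      IsRegular S rs → (∀ r ∈ rs, r ∈ maximalIdeal S) →
      (rs.length : WithBot ℕ∞) = ringKrullDim S →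
      ∀ s : Fin n → S, IsSystemOfParameters s → IsWeaklyRegular S (List.ofFn s) := by
  induction n with
  | zero =>
    intro S _ _ _ _ _ _ _ _ _
    rw [List.ofFn_zero]
    exact IsWeaklyRegular.nil S S
  | succ n ih =>
    intro S _ _ _ rs hrs hmem hdim s hs
    obtain ⟨hd, hrad⟩ := hs
    have hxm : s 0 ∈ maximalIdeal S := by
      rw [← hrad]
      exact Ideal.le_radical (Ideal.subset_span ⟨0, rfl⟩)
    have hlen : rs.length = n + 1 := by
      rw [hd] at hdim
      exact_mod_cast hdim
    -- (1) the local ring `S̄ = S/(x)`, `x = s 0`, and the images `s̄'` of `s 1, …, s n`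
    obtain ⟨hSnt, hSloc⟩ := isLocalRing_quotient_span_singleton hxm
    set Sb := S ⧸ Ideal.span {s 0}
    set mk := Ideal.Quotient.mk (Ideal.span {s 0})
    set s' : Fin n → Sb := fun i => mk (s i.succ)
    have hmap : Ideal.map mk (Ideal.span (Set.range s)) = Ideal.span (Set.range s') := by
      refine le_antisymm ?_ ?_
      · rw [Ideal.map_span, Ideal.span_le]
        rintro _ ⟨_, ⟨i, rfl⟩, rfl⟩
        refine Fin.cases ?_ (fun j => ?_) i
        · have h0 : mk (s 0) = 0 :=
            Ideal.Quotient.eq_zero_iff_mem.mpr (Ideal.mem_span_singleton_self _)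
          rw [h0]
          exact SetLike.mem_coe.mpr (zero_mem _)
        · exact Ideal.subset_span ⟨j, rfl⟩
      · rw [Ideal.span_le]
        rintro _ ⟨j, rfl⟩
        exact Ideal.mem_map_of_mem mk (Ideal.subset_span ⟨j.succ, rfl⟩)
    have hrad' : (Ideal.span (Set.range s')).radical = maximalIdeal Sb := by
      have hker : RingHom.ker mk ≤ Ideal.span (Set.range s) := by
        rw [Ideal.mk_ker, Ideal.span_singleton_le_iff_mem]
        exact Ideal.subset_span ⟨0, rfl⟩
      rw [← hmap, ← Ideal.map_radical_of_surjective Ideal.Quotient.mk_surjective hker, hrad,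
        maximalIdeal_quotient_eq_map (Ideal.span {s 0})]
    -- (2) `dim S̄ ≤ n` (Krull's height theorem: `𝔪̄` is minimal over the `n`-generated `(s̄')`)
    have hmin : maximalIdeal Sb ∈ (Ideal.span (Set.range s')).minimalPrimes := by
      rw [← Ideal.radical_minimalPrimes, hrad', Ideal.minimalPrimes_eq_subsingleton_self]
      exact Set.mem_singleton _
    obtain ⟨m, hm⟩ := exists_nat_cast_eq_ringKrullDim (R := Sb)
    have hheight : (maximalIdeal Sb).height = m := by
      have h := IsLocalRing.maximalIdeal_height_eq_ringKrullDim (R := Sb)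
      rw [hm] at h
      exact_mod_cast h
    have hmn : m ≤ n := by
      have h1 := Ideal.height_le_card_of_mem_minimalPrimes_span (Set.finite_range s') hmin
      rw [hheight] at h1
      have h2 : (Set.range s').ncard ≤ n := by
        rw [← Set.image_univ]
        refine (Set.ncard_image_le Set.finite_univ).trans ?_
        rw [Set.ncard_univ, Nat.card_eq_fintype_card, Fintype.card_fin]
      exact le_trans (by exact_mod_cast h1) h2
    have hdimle : ringKrullDim Sb ≤ n := by
      rw [hm]
      exact_mod_cast hmn
    -- (3) `x` lies in no associated prime of `S` (unmixedness), hence is a non-zero-divisor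
    have hx0 : s 0 ∈ nonZeroDivisors S := by
      by_contra hx0
      have h1 : s 0 ∈ ⋃ p ∈ associatedPrimes S S, (p : Set S) := by
        rw [biUnion_associatedPrimes_eq_compl_nonZeroDivisors]
        exact hx0
      obtain ⟨p, hp, hxp⟩ := Set.mem_iUnion₂.mp h1
      have h2 := length_le_coheight_of_mem_associatedPrimes hrs hmem hp
      have h3 := coheight_le_ringKrullDim_quotient (I := Ideal.span {s 0})
        ⟨p, IsAssociatedPrime.isPrime hp⟩ ((Ideal.span_singleton_le_iff_mem _).mpr hxp)
      have h4 := ((WithBot.coe_le_coe.mpr h2).trans h3).trans hdimle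
      rw [hlen] at h4
      have h5 : n + 1 ≤ n := by exact_mod_cast h4
      omega
    have hxreg : IsSMulRegular S (s 0) :=
      (isRegular_iff_mem_nonZeroDivisors.mpr hx0).left.isSMulRegular
    -- (4) `S̄` is again Cohen–Macaulay, of dimension `n` (cutting down)
    obtain ⟨rs₁, hlen₁, hmem₁, hreg₁⟩ := exists_isRegular_quotSMulTop hrs hmem hxreg hxm
    obtain ⟨hmem₂, hreg₂⟩ := isRegular_quotient_of_isRegular_quotSMulTop hxm hreg₁ hmem₁
    have hdimSb : ringKrullDim Sb = n := by
      have h1 := ringKrullDim_quotient_span_singleton_succ_eq_ringKrullDim hxreg hxm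
      rw [hd, hm] at h1
      have h2 : m + 1 = n + 1 := by exact_mod_cast h1
      rw [hm]
      exact_mod_cast (by omega : m = n)
    have hdim₂ : ((rs₁.map mk).length : WithBot ℕ∞) = ringKrullDim Sb := by
      rw [hdimSb, List.length_map, hlen₁, hlen, Nat.add_sub_cancel]
    -- (5) induction hypothesis for the system of parameters `s̄'` of `S̄`, pulled back to `S`
    have ih' : IsWeaklyRegular Sb (List.ofFn s') :=
      ih Sb (rs₁.map mk) hreg₂ hmem₂ hdim₂ s' ⟨hdimSb, hrad'⟩
    have hw : IsWeaklyRegular Sb (List.ofFn fun i => s i.succ) := by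
      have h := (isWeaklyRegular_map_algebraMap_iff Sb Sb (List.ofFn fun i => s i.succ)).mp
      rw [Ideal.Quotient.algebraMap_eq, List.map_ofFn] at h
      exact h ih'
    have heq : ((s 0) • (⊤ : Submodule S S)) = Ideal.span {s 0} := by
      rw [← Submodule.ideal_span_singleton_smul, smul_eq_mul, Ideal.mul_top]
    let e : QuotSMulTop (s 0) S ≃ₗ[S] Sb := Submodule.quotEquivOfEq _ _ heq
    have hw' : IsWeaklyRegular (QuotSMulTop (s 0) S) (List.ofFn fun i => s i.succ) :=
      (e.isWeaklyRegular_congr _).mpr hw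
    rw [List.ofFn_succ]
    exact IsWeaklyRegular.cons hxreg hw'

/-- **In a Cohen–Macaulay local ring every system of parameters is a (weakly) regular sequence**
(Matsumura, Thm. 17.4 (iii)): if the Noetherian local ring `(S, 𝔪)` has an `S`-regular sequence
in `𝔪` of length `dim S`, then every system of parameters `s` (`dim S` elements, `rad (s) = 𝔪`)
is a weakly regular sequence on `S` in the given order. [cite: Matsumura1987, Thm. 17.4 (iii)] -/
theorem stub_sopWeaklyRegular {S : Type*} [CommRing S] [IsNoetherianRing S] [IsLocalRing S]
    (hCM : ∃ rs : List S, RingTheory.Sequence.IsRegular S rs ∧ (∀ r ∈ rs, r ∈ maximalIdeal S) ∧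
      (rs.length : WithBot ℕ∞) = ringKrullDim S)
    ⦃n : ℕ⦄ (s : Fin n → S) (hs : IsSystemOfParameters s) :
    RingTheory.Sequence.IsWeaklyRegular S (List.ofFn s) := by
  obtain ⟨rs, hrs, hmem, hdim⟩ := hCM
  exact isWeaklyRegular_ofFn_of_isSystemOfParameters_aux n S rs hrs hmem hdim s hs

end Summit.ResolutionOfSingularities.ResolutionOfSingularities.Theorems.FRationalModification.SopWeaklyRegular
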